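import Literature.Computation.Certificates.DyadicCholResidualWitness
import Literature.Computation.Certificates.LeastEigenvalueEnclosure
import HarnessLib

/-!
# Ball certificates that name only the radius ROW SUMS

Topic `Literature/Computation/Certificates` (cell certnum, layer L1; the BALL bodies of the streamed
member of `cap.ila.psd`, `pub/certnum/ila/FORMAT-psd-stream.md` v0.6 (1) «BALL IDENTITY» and v0.6 (5)
«the three replay statuses», written 2026-08-27).

A streamed `psd-chol-residual-stream/1` certificate of a BALL `{A : |A − C| ≤ Δ entrywise}` is
produced from a source that carries the midpoint `C` and, of the radius matrix `Δ ≥ 0`, only its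
ROW SUMS `s i = Σ_j Δ i j` (named inside `M_ref` by `radrowsums_sha256` from 0.5.3 on).  Both verdicts
such a document prints depend on `Δ` only through `s`:

* FLOOR (Rump 1999 §4, Algorithm 4.1 step 7 with toleranced data): the row-sum acceptance test reads
  `Σ_j ‖E i j‖ + t²d · s i ≤ r`, and then `A − ((tσ − r)/(t²d))·1 ⪰ 0` for EVERY Hermitian `A` in
  EVERY ball around `C` whose entrywise-nonnegative radii have row sums `≤ s`
  (`posSemidef_sub_smul_one_of_ball_rowsums`, acceptance and eigenvalue forms) — the typed content of
  the sentence «a body naming only `radrowsums_sha256` certifies the floor for every ball whose radius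
  row sums are these»;
* CEILING, the ROW-SUM rule / replay status (b): with `B ≥ |x i|` for all `i`, the recorded penalty
  bound is tested against `F = B · Σ_i |x i| · s i`, and `F ≥ |x|ᵀΔ|x|` for every such `Δ`
  (private helper `abs_dotProduct_mulVec_abs_le_of_rowsums_le`, from
  `LeastEigenvalueEnclosure.abs_dotProduct_mulVec_abs_le_mul_sum_rowsum`), so `∃ i, λᵢ(A) ≤ (xᵀCx + P)/xᵀx` for any recorded
  `P ≥ F` (`exists_eigenvalues_le_div_of_rowsums_le`), a negative such ceiling refutes positive
  semidefiniteness of every member (`not_posSemidef_of_rowsums_rule_neg`), and the literal integer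
  arithmetic of a reader that holds integer row-sum numerators `srow` over `den`
  (`exists_eigenvalues_le_record_ceiling_of_rowsums`).

Everything is a corollary of `DyadicCholResidualWitness.posSemidef_sub_smul_one_of_ball` and of
`LeastEigenvalueEnclosure.exists_eigenvalues_le_div_of_penalty_le` /
`abs_dotProduct_mulVec_abs_le_mul_sum_rowsum` by monotonicity in the row sums; no named fact, no
instance, no `sorry`.

References: S. M. Rump, *Verified solution of large linear and nonlinear systems* (1999) §4
[cite: Rump1999VerifiedLargeSystems, §4 Algorithm 4.1 steps 6–7 (PDF p. 243)]; R. A. Horn,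
C. R. Johnson, *Matrix Analysis* (2nd ed. 2013), Thm. 4.2.2 [cite: HornJohnson2013, Thm. 4.2.2].
-/

noncomputable section

open Matrix Finset
open scoped ComplexOrder

namespace Literature.Computation.Certificates.RadiusRowSumCertificates

open Literature.Computation.Certificates.DyadicCholResidualWitness
open Literature.Computation.Certificates.LeastEigenvalueEnclosure

/-! ### Floor side: the acceptance test reads the radius row sums only -/

section Floor

variable {𝕜 : Type*} [RCLike 𝕜] {m k : Type*} [Fintype m] [Fintype k] [DecidableEq m]

/-- From the row-sums-only acceptance datum `Σ_j ‖E i j‖ + t²d·s i ≤ r` and `Σ_j Δ i j ≤ s i`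
recover the entrywise hypothesis `Σ_j (‖E i j‖ + t²d·Δ i j) ≤ r` of the ball witness. [folklore] -/
private theorem rowsum_hyp_of_rowsums {C : Matrix m m 𝕜} (R : Matrix k m 𝕜) {Δ : Matrix m m ℝ}
    {s : m → ℝ} {d t σ r : ℝ} (hd : 0 < d)
    (hrow : ∀ i, (∑ j, ‖residual C R d t σ i j‖) + t ^ 2 * d * s i ≤ r)
    (hΔs : ∀ i, ∑ j, Δ i j ≤ s i) (i : m) :
    ∑ j, (‖residual C R d t σ i j‖ + t ^ 2 * d * Δ i j) ≤ r := by
  have hdt : 0 ≤ t ^ 2 * d := by positivity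
  rw [Finset.sum_add_distrib, ← Finset.mul_sum]
  calc ∑ j, ‖residual C R d t σ i j‖ + t ^ 2 * d * ∑ j, Δ i j
      ≤ ∑ j, ‖residual C R d t σ i j‖ + t ^ 2 * d * s i := by gcongr; exact hΔs i
    _ ≤ r := hrow i

/-- **Ball floor from radius ROW SUMS only** (shifted form).  If the exact residual
`E = t²·(d·C) − (t·σ)·1 − RᴴR` of the midpoint satisfies `Σ_j ‖E i j‖ + t²d · s i ≤ r` for every row
`i`, then for EVERY radius matrix `Δ` with `Σ_j Δ i j ≤ s i` and every Hermitian `A` with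
`‖A i j − C i j‖ ≤ Δ i j`, `A − ((tσ − r)/(t²d))·1` is positive semidefinite — the floor of a
streamed BALL body is a statement about the named radius row sums (cap.ila.psd `radrowsums_sha256`).
[cite: Rump1999VerifiedLargeSystems, §4 Algorithm 4.1 steps 6–7 with toleranced data (PDF p. 243)] -/
theorem posSemidef_sub_smul_one_of_ball_rowsums {A C : Matrix m m 𝕜} (hA : A.IsHermitian)
    (R : Matrix k m 𝕜) (s : m → ℝ) {d t σ r : ℝ} (hd : 0 < d) (ht : 0 < t)
    (hrow : ∀ i, (∑ j, ‖residual C R d t σ i j‖) + t ^ 2 * d * s i ≤ r)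
    (Δ : Matrix m m ℝ) (hΔs : ∀ i, ∑ j, Δ i j ≤ s i)
    (hAC : ∀ i j, ‖A i j - C i j‖ ≤ Δ i j) :
    (A - (((t * σ - r) / (t ^ 2 * d) : ℝ) : 𝕜) • (1 : Matrix m m 𝕜)).PosSemidef :=
  posSemidef_sub_smul_one_of_ball hA R Δ hd ht (rowsum_hyp_of_rowsums R hd hrow hΔs) hAC

/-- **Ball floor from radius row sums, acceptance form**: with `r ≤ t·σ` every Hermitian member of
every ball around `C` whose radii have row sums `≤ s` is positive semidefinite.
[cite: Rump1999VerifiedLargeSystems, §4 Algorithm 4.1 step 7 (PDF p. 243)] -/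
theorem posSemidef_of_le_of_ball_rowsums {A C : Matrix m m 𝕜} (hA : A.IsHermitian)
    (R : Matrix k m 𝕜) (s : m → ℝ) {d t σ r : ℝ} (hd : 0 < d) (ht : 0 < t)
    (hrow : ∀ i, (∑ j, ‖residual C R d t σ i j‖) + t ^ 2 * d * s i ≤ r)
    (Δ : Matrix m m ℝ) (hΔs : ∀ i, ∑ j, Δ i j ≤ s i)
    (hAC : ∀ i j, ‖A i j - C i j‖ ≤ Δ i j) (hacc : r ≤ t * σ) : A.PosSemidef :=
  posSemidef_of_le_of_ball hA R Δ hd ht (rowsum_hyp_of_rowsums R hd hrow hΔs) hAC hacc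

/-- **Ball floor from radius row sums, eigenvalue form**: every eigenvalue of every Hermitian member
of every ball around `C` whose radii have row sums `≤ s` is `≥ (tσ − r)/(t²d)` (the `floor` field).
[cite: Rump1999VerifiedLargeSystems, §4 eq. after (12) (PDF p. 243)] -/
theorem le_eigenvalues₀_of_ball_rowsums {A C : Matrix m m 𝕜} (hA : A.IsHermitian)
    (R : Matrix k m 𝕜) (s : m → ℝ) {d t σ r : ℝ} (hd : 0 < d) (ht : 0 < t)
    (hrow : ∀ i, (∑ j, ‖residual C R d t σ i j‖) + t ^ 2 * d * s i ≤ r)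
    (Δ : Matrix m m ℝ) (hΔs : ∀ i, ∑ j, Δ i j ≤ s i)
    (hAC : ∀ i j, ‖A i j - C i j‖ ≤ Δ i j) (i : Fin (Fintype.card m)) :
    (t * σ - r) / (t ^ 2 * d) ≤ hA.eigenvalues₀ i :=
  le_eigenvalues₀_of_ball hA R Δ hd ht (rowsum_hyp_of_rowsums R hd hrow hΔs) hAC i

end Floor

/-! ### Ceiling side: the ROW-SUM rule of a `psd-rayleigh-ceiling/1` replay (status (b)) -/

section Ceiling

variable {m : Type*} [Fintype m]

/-- **The row-sum majorant dominates the exact penalty for every radius matrix with those row sums.**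
For entrywise `Δ ≥ 0` with `Σ_j Δ i j ≤ s i`, any `B` with `|x i| ≤ B` for all `i`:
`|x|ᵀΔ|x| ≤ B · Σ_i |x i| · s i` (=: `F`, the quantity a row-sums-only reader tests the recorded
bound against); private plumbing for the two cited rules below. [folklore] -/
private theorem abs_dotProduct_mulVec_abs_le_of_rowsums_le {Δ : Matrix m m ℝ} (hΔ : ∀ i j, 0 ≤ Δ i j)
    {s : m → ℝ} (hs : ∀ i, ∑ j, Δ i j ≤ s i) {x : m → ℝ} {B : ℝ} (hB : ∀ i, |x i| ≤ B) :
    |x| ⬝ᵥ Δ *ᵥ |x| ≤ B * ∑ i, |x i| * s i := by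
  refine (abs_dotProduct_mulVec_abs_le_mul_sum_rowsum hΔ hB).trans ?_
  rw [Finset.mul_sum, Finset.mul_sum]
  refine Finset.sum_le_sum fun i _ ↦ ?_
  have hB0 : 0 ≤ B := (abs_nonneg (x i)).trans (hB i)
  have h1 : |x i| * ∑ j, Δ i j ≤ |x i| * s i := mul_le_mul_of_nonneg_left (hs i) (abs_nonneg _)
  exact mul_le_mul_of_nonneg_left h1 hB0

variable [DecidableEq m]

/-- **ROW-SUM rule, replay status (b).**  For symmetric `A` in the ball `|A i j − C i j| ≤ Δ i j`
whose radii have row sums `Σ_j Δ i j ≤ s i`, a test vector `x ≠ 0`, `B ≥ |x i|` for all `i` and ANY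
recorded bound `P ≥ B · Σ_i |x i| · s i`: `∃ i, λᵢ(A) ≤ (xᵀCx + P)/xᵀx` — the ceiling holds for every
ball with these row sums, which is what a reader that holds only the row sums can certify.
[cite: HornJohnson2013, Thm. 4.2.2] -/
theorem exists_eigenvalues_le_div_of_rowsums_le {A C Δ : Matrix m m ℝ} (hA : A.IsHermitian)
    (hΔ : ∀ i j, |A i j - C i j| ≤ Δ i j) {s : m → ℝ} (hs : ∀ i, ∑ j, Δ i j ≤ s i)
    {x : m → ℝ} (hx : 0 < x ⬝ᵥ x) {B : ℝ} (hB : ∀ i, |x i| ≤ B) {P : ℝ}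
    (hP : B * ∑ i, |x i| * s i ≤ P) :
    ∃ i, hA.eigenvalues i ≤ (x ⬝ᵥ C *ᵥ x + P) / (x ⬝ᵥ x) :=
  exists_eigenvalues_le_div_of_penalty_le hA hΔ hx
    ((abs_dotProduct_mulVec_abs_le_of_rowsums_le (fun i j ↦ (abs_nonneg _).trans (hΔ i j)) hs hB).trans
      hP)

/-- **Indefiniteness by a ROW-SUM-rule ceiling**: under the same hypotheses, `xᵀCx + P < 0` ⇒ NO
member of any ball around `C` with radius row sums `≤ s` is positive semidefinite (the certificate
field `indefinite_by_ceiling`, for every member). [cite: HornJohnson2013, Thm. 4.2.2] -/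
theorem not_posSemidef_of_rowsums_rule_neg {A C Δ : Matrix m m ℝ}
    (hΔ : ∀ i j, |A i j - C i j| ≤ Δ i j) {s : m → ℝ} (hs : ∀ i, ∑ j, Δ i j ≤ s i)
    {x : m → ℝ} (hx : 0 < x ⬝ᵥ x) {B : ℝ} (hB : ∀ i, |x i| ≤ B) {P : ℝ}
    (hP : B * ∑ i, |x i| * s i ≤ P) (hneg : x ⬝ᵥ C *ᵥ x + P < 0) : ¬ A.PosSemidef :=
  not_posSemidef_of_form_add_penalty_neg hΔ hx
    ((abs_dotProduct_mulVec_abs_le_of_rowsums_le (fun i j ↦ (abs_nonneg _).trans (hΔ i j)) hs hB).trans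
      hP) hneg

/-- **The record arithmetic with integer ROW SUMS (what a streamed-ball reader holds).**  For integer
`Mnum`, a positive denominator `den`, integer radius row-sum numerators `srow`, an integer test
vector `v ≠ 0`, an integer `B ≥ |v i|` and ANY integer `bound ≥ B · Σ_i |v i| · srow i`: every
symmetric `A` lying in SOME ball `|A i j − Mnum i j / den| ≤ Rad i j / den` with `Rad ≥ 0` and
`Σ_j Rad i j ≤ srow i` has an eigenvalue `≤ (vᵀ·Mnum·v + bound)/(den · vᵀv)` — the `ceiling` field
replayed from row sums (FORMAT-psd-stream v0.6 (5) status (b): recorded `≥ F` ⇒ PASS).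
[cite: HornJohnson2013, Thm. 4.2.2] -/
theorem exists_eigenvalues_le_record_ceiling_of_rowsums {A : Matrix m m ℝ} (hA : A.IsHermitian)
    {Mnum Rad : Matrix m m ℤ} {den : ℕ} (hden : 0 < den) (hRad : ∀ i j, 0 ≤ Rad i j)
    {srow : m → ℤ} (hs : ∀ i, ∑ j, Rad i j ≤ srow i)
    (hΔ : ∀ i j, |A i j - (Mnum i j : ℝ) / den| ≤ (Rad i j : ℝ) / den) {v : m → ℤ}
    (hv : 0 < v ⬝ᵥ v) {B : ℤ} (hB : ∀ i, |v i| ≤ B) {bound : ℤ}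
    (hbound : B * ∑ i, |v i| * srow i ≤ bound) :
    ∃ i, hA.eigenvalues i ≤
      ((v ⬝ᵥ Mnum *ᵥ v + bound : ℤ) : ℝ) / ((den : ℝ) * ((v ⬝ᵥ v : ℤ) : ℝ)) := by
  refine exists_eigenvalues_le_record_ceiling hA hden hΔ hv (hbound.trans' ?_)
  -- the integer inequality `|v|ᵀ·Rad·|v| ≤ B · Σ_i |v i| · srow i`, proved over `ℝ` and cast back
  have hx : ∀ i, |((v i : ℤ) : ℝ)| ≤ (B : ℝ) := fun i ↦ by exact_mod_cast hB i
  have hR : ∀ i j, (0 : ℝ) ≤ ((Rad i j : ℤ) : ℝ) := fun i j ↦ by exact_mod_cast hRad i j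
  have hsr : ∀ i, ∑ j, ((Rad i j : ℤ) : ℝ) ≤ ((srow i : ℤ) : ℝ) := fun i ↦ by exact_mod_cast hs i
  have h := abs_dotProduct_mulVec_abs_le_of_rowsums_le (Δ := fun i j ↦ ((Rad i j : ℤ) : ℝ))
    (x := fun i ↦ ((v i : ℤ) : ℝ)) hR hsr hx
  have hl : ((|v| ⬝ᵥ Rad *ᵥ |v| : ℤ) : ℝ) =
      |(fun i ↦ ((v i : ℤ) : ℝ))| ⬝ᵥ (fun i j ↦ ((Rad i j : ℤ) : ℝ)) *ᵥ |(fun i ↦ ((v i : ℤ) : ℝ))| := by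
    simp only [dotProduct, mulVec, Pi.abs_apply, Int.cast_sum, Int.cast_mul, Int.cast_abs]
  have hr : (((B * ∑ i, |v i| * srow i : ℤ)) : ℝ) = (B : ℝ) * ∑ i, |((v i : ℤ) : ℝ)| * ((srow i : ℤ) : ℝ) := by
    simp only [Int.cast_mul, Int.cast_sum, Int.cast_abs]
  exact_mod_cast (hl ▸ hr ▸ h)

end Ceiling

/-! ### The QUADRATIC row-sum majorant (cap.ila.psd 0.5.3, FORMAT-psd-stream v0.7 (1))

For a SYMMETRIC entrywise-nonnegative radius matrix `Δ` (the radius matrix of a ball of symmetric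
matrices is symmetric by construction: producers hand over its lower triangle) the elementary
inequality `2·|xᵢ|·|xⱼ| ≤ xᵢ² + xⱼ²` gives a majorant of the exact penalty that ALSO reads only the
radius row sums and the test vector, but is never above the row-sum rule `F = B·Σᵢ |xᵢ|·sᵢ` of the
previous section: `|x|ᵀΔ|x| ≤ G := Σᵢ sᵢ·xᵢ² ≤ F` (the second inequality is `sᵢ·xᵢ² = sᵢ·|xᵢ|·|xᵢ| ≤
sᵢ·|xᵢ|·B` termwise, so a reader testing against `G` accepts every record a reader testing against `F`
accepts).  A streamed producer that carries only the row sums records `G` (the «quadratic row-sum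
rule»), and a reader holding only the row sums tests the recorded bound against `G` (replay status (b)
with the HOLD band `[pen_exact, G)` instead of `[pen_exact, F)`). -/

section Quadratic

variable {m : Type*} [Fintype m]

/-- `2ab ≤ a² + b²` in the form used below. [folklore] -/
private theorem two_mul_le_sq_add_sq (a b : ℝ) : 2 * (a * b) ≤ a ^ 2 + b ^ 2 := by
  nlinarith [sq_nonneg (a - b)]

/-- **Quadratic row-sum majorant.**  For a SYMMETRIC entrywise-nonnegative `Δ` and any real vector
`x`: `|x|ᵀΔ|x| ≤ Σᵢ (Σⱼ Δᵢⱼ)·xᵢ²` — by `2|xᵢ||xⱼ| ≤ xᵢ² + xⱼ²` termwise and symmetry (the two halves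
`Σᵢⱼ Δᵢⱼ xᵢ²` and `Σᵢⱼ Δᵢⱼ xⱼ²` coincide).  Private plumbing for the cited rules below. [folklore] -/
private theorem abs_dotProduct_mulVec_abs_le_sum_rowsum_mul_sq {Δ : Matrix m m ℝ}
    (hΔ : ∀ i j, 0 ≤ Δ i j) (hsym : ∀ i j, Δ i j = Δ j i) (x : m → ℝ) :
    |x| ⬝ᵥ Δ *ᵥ |x| ≤ ∑ i, (∑ j, Δ i j) * x i ^ 2 := by
  have h1 : |x| ⬝ᵥ Δ *ᵥ |x| = ∑ i, ∑ j, Δ i j * (|x i| * |x j|) := by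
    simp only [dotProduct, mulVec, Pi.abs_apply, Finset.mul_sum]
    exact Finset.sum_congr rfl fun i _ ↦ Finset.sum_congr rfl fun j _ ↦ by ring
  -- termwise AM–GM: Δᵢⱼ·|xᵢ||xⱼ| ≤ Δᵢⱼ·(xᵢ² + xⱼ²)/2
  have h2 : ∑ i, ∑ j, Δ i j * (|x i| * |x j|) ≤ ∑ i, ∑ j, Δ i j * ((x i ^ 2 + x j ^ 2) / 2) := by
    refine Finset.sum_le_sum fun i _ ↦ Finset.sum_le_sum fun j _ ↦
      mul_le_mul_of_nonneg_left ?_ (hΔ i j)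
    have := two_mul_le_sq_add_sq (|x i|) (|x j|)
    rw [sq_abs, sq_abs] at this
    linarith
  -- split the right-hand side into the two (equal, by symmetry) halves
  have h3 : ∑ i, ∑ j, Δ i j * ((x i ^ 2 + x j ^ 2) / 2)
      = (∑ i, ∑ j, Δ i j * x i ^ 2) / 2 + (∑ i, ∑ j, Δ i j * x j ^ 2) / 2 := by
    rw [Finset.sum_div, Finset.sum_div, ← Finset.sum_add_distrib]
    refine Finset.sum_congr rfl fun i _ ↦ ?_
    rw [Finset.sum_div, Finset.sum_div, ← Finset.sum_add_distrib]
    exact Finset.sum_congr rfl fun j _ ↦ by ring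
  have h4 : ∑ i, ∑ j, Δ i j * x j ^ 2 = ∑ i, ∑ j, Δ i j * x i ^ 2 := by
    rw [Finset.sum_comm]
    exact Finset.sum_congr rfl fun i _ ↦ Finset.sum_congr rfl fun j _ ↦ by rw [hsym j i]
  have h5 : ∑ i, ∑ j, Δ i j * x i ^ 2 = ∑ i, (∑ j, Δ i j) * x i ^ 2 :=
    Finset.sum_congr rfl fun i _ ↦ by rw [Finset.sum_mul]
  rw [h1]
  refine h2.trans (le_of_eq ?_)
  rw [h3, h4, h5]
  ring

/-- With row sums bounded by `s` (`Σⱼ Δᵢⱼ ≤ sᵢ`): `|x|ᵀΔ|x| ≤ Σᵢ sᵢ·xᵢ²` =: `G`, the figure a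
row-sums-only producer records and a row-sums-only reader tests against. [folklore] -/
private theorem abs_dotProduct_mulVec_abs_le_sum_rowsums_mul_sq {Δ : Matrix m m ℝ}
    (hΔ : ∀ i j, 0 ≤ Δ i j) (hsym : ∀ i j, Δ i j = Δ j i) {s : m → ℝ} (hs : ∀ i, ∑ j, Δ i j ≤ s i)
    (x : m → ℝ) : |x| ⬝ᵥ Δ *ᵥ |x| ≤ ∑ i, s i * x i ^ 2 :=
  (abs_dotProduct_mulVec_abs_le_sum_rowsum_mul_sq hΔ hsym x).trans
    (Finset.sum_le_sum fun i _ ↦ mul_le_mul_of_nonneg_right (hs i) (sq_nonneg _))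

variable [DecidableEq m]

/-- **QUADRATIC ROW-SUM rule** (the streamed producer's rule for sources that carry only the radius
row sums, cap.ila.psd ≥ 0.5.3; replay status (b) of FORMAT-psd-stream v0.7 (1)).  For symmetric `A` in
the ball `|A i j − C i j| ≤ Δ i j` with `Δ` SYMMETRIC and `Σ_j Δ i j ≤ s i`, a test vector `x ≠ 0` and
ANY recorded bound `P ≥ Σ_i s i · (x i)²`: `∃ i, λᵢ(A) ≤ (xᵀCx + P)/xᵀx` — valid for every ball with
these radius row sums. [cite: HornJohnson2013, Thm. 4.2.2] -/
theorem exists_eigenvalues_le_div_of_sq_rowsums_le {A C Δ : Matrix m m ℝ} (hA : A.IsHermitian)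
    (hΔ : ∀ i j, |A i j - C i j| ≤ Δ i j) (hsym : ∀ i j, Δ i j = Δ j i) {s : m → ℝ}
    (hs : ∀ i, ∑ j, Δ i j ≤ s i) {x : m → ℝ} (hx : 0 < x ⬝ᵥ x) {P : ℝ}
    (hP : ∑ i, s i * x i ^ 2 ≤ P) :
    ∃ i, hA.eigenvalues i ≤ (x ⬝ᵥ C *ᵥ x + P) / (x ⬝ᵥ x) :=
  exists_eigenvalues_le_div_of_penalty_le hA hΔ hx
    ((abs_dotProduct_mulVec_abs_le_sum_rowsums_mul_sq (fun i j ↦ (abs_nonneg _).trans (hΔ i j)) hsym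
      hs x).trans hP)

/-- **Indefiniteness by a QUADRATIC-row-sum ceiling**: under the same hypotheses, `xᵀCx + P < 0` ⇒ no
member of any ball around `C` with symmetric radii of row sums `≤ s` is positive semidefinite.
[cite: HornJohnson2013, Thm. 4.2.2] -/
theorem not_posSemidef_of_sq_rowsums_rule_neg {A C Δ : Matrix m m ℝ}
    (hΔ : ∀ i j, |A i j - C i j| ≤ Δ i j) (hsym : ∀ i j, Δ i j = Δ j i) {s : m → ℝ}
    (hs : ∀ i, ∑ j, Δ i j ≤ s i) {x : m → ℝ} (hx : 0 < x ⬝ᵥ x) {P : ℝ}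
    (hP : ∑ i, s i * x i ^ 2 ≤ P) (hneg : x ⬝ᵥ C *ᵥ x + P < 0) : ¬ A.PosSemidef :=
  not_posSemidef_of_form_add_penalty_neg hΔ hx
    ((abs_dotProduct_mulVec_abs_le_sum_rowsums_mul_sq (fun i j ↦ (abs_nonneg _).trans (hΔ i j)) hsym
      hs x).trans hP) hneg

/-- **The record arithmetic with integer ROW SUMS, quadratic rule.**  For integer `Mnum`, a positive
denominator `den`, integer radius row-sum numerators `srow`, an integer test vector `v ≠ 0` and ANY
integer `bound ≥ Σ_i srow i · (v i)²`: every symmetric `A` in SOME ball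
`|A i j − Mnum i j / den| ≤ Rad i j / den` with `Rad ≥ 0` SYMMETRIC and `Σ_j Rad i j ≤ srow i` has an
eigenvalue `≤ (vᵀ·Mnum·v + bound)/(den · vᵀv)` — the `ceiling` field of a record produced under the
quadratic row-sum rule, replayed from row sums (recorded `≥ G` ⇒ PASS).
[cite: HornJohnson2013, Thm. 4.2.2] -/
theorem exists_eigenvalues_le_record_ceiling_of_sq_rowsums {A : Matrix m m ℝ} (hA : A.IsHermitian)
    {Mnum Rad : Matrix m m ℤ} {den : ℕ} (hden : 0 < den) (hRad : ∀ i j, 0 ≤ Rad i j)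
    (hRsym : ∀ i j, Rad i j = Rad j i) {srow : m → ℤ} (hs : ∀ i, ∑ j, Rad i j ≤ srow i)
    (hΔ : ∀ i j, |A i j - (Mnum i j : ℝ) / den| ≤ (Rad i j : ℝ) / den) {v : m → ℤ}
    (hv : 0 < v ⬝ᵥ v) {bound : ℤ} (hbound : ∑ i, srow i * v i ^ 2 ≤ bound) :
    ∃ i, hA.eigenvalues i ≤
      ((v ⬝ᵥ Mnum *ᵥ v + bound : ℤ) : ℝ) / ((den : ℝ) * ((v ⬝ᵥ v : ℤ) : ℝ)) := by
  refine exists_eigenvalues_le_record_ceiling hA hden hΔ hv (hbound.trans' ?_)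
  -- the integer inequality `|v|ᵀ·Rad·|v| ≤ Σ_i srow i · (v i)²`, proved over `ℝ` and cast back
  have hR : ∀ i j, (0 : ℝ) ≤ ((Rad i j : ℤ) : ℝ) := fun i j ↦ by exact_mod_cast hRad i j
  have hRs : ∀ i j, ((Rad i j : ℤ) : ℝ) = ((Rad j i : ℤ) : ℝ) := fun i j ↦ by rw [hRsym i j]
  have hsr : ∀ i, ∑ j, ((Rad i j : ℤ) : ℝ) ≤ ((srow i : ℤ) : ℝ) := fun i ↦ by exact_mod_cast hs i
  have h := abs_dotProduct_mulVec_abs_le_sum_rowsums_mul_sq (Δ := fun i j ↦ ((Rad i j : ℤ) : ℝ))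
    hR hRs hsr (fun i ↦ ((v i : ℤ) : ℝ))
  have hl : ((|v| ⬝ᵥ Rad *ᵥ |v| : ℤ) : ℝ) =
      |(fun i ↦ ((v i : ℤ) : ℝ))| ⬝ᵥ (fun i j ↦ ((Rad i j : ℤ) : ℝ)) *ᵥ |(fun i ↦ ((v i : ℤ) : ℝ))| := by
    simp only [dotProduct, mulVec, Pi.abs_apply, Int.cast_sum, Int.cast_mul, Int.cast_abs]
  have hr : (((∑ i, srow i * v i ^ 2 : ℤ)) : ℝ) = ∑ i, ((srow i : ℤ) : ℝ) * ((v i : ℤ) : ℝ) ^ 2 := by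
    simp only [Int.cast_sum, Int.cast_mul, Int.cast_pow]
  exact_mod_cast (hl ▸ hr ▸ h)

end Quadratic

end Literature.Computation.Certificates.RadiusRowSumCertificates

end
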